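import Literature.MathematicalPhysics.QuantumFieldTheory.OSDistributionSpaceSemigroup
import Mathlib.Analysis.SpecialFunctions.ContinuousFunctionalCalculus.Rpow.Basic
import Mathlib.Analysis.CStarAlgebra.ContinuousLinearMap
import Mathlib.Analysis.InnerProductSpace.StarOrder
import HarnessLib

/-!
# The OS semigroup in the continuous functional calculus: `e^{-tH} = (e^{-H})^t` on dyadic `t`

Osterwalder–Schrader I (CMP 31 (1973)), §4.1, p. 92: "Let `H` be the infinitesimal generator of
`T^t`. It is a positive self-adjoint operator on `ℋ` … The family `T^τ = e^{-τH}`, `τ = t + is`,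
is a holomorphic semigroup for `Re τ > 0`". Mathlib has no spectral theorem for unbounded
self-adjoint operators, but it has the continuous functional calculus (CFC) for positive bounded
operators on a Hilbert space (`H →L[ℂ] H` is a C⋆-algebra and a `StarOrderedRing`). The bounded
positive contraction `A = e^{-t₀H} = shiftH hE2 t₀` (`OSDistributionSpaceSemigroup`:
`shiftH_nonneg`) therefore has CFC powers `A ^ x` (`CFC.nnrpow`, `x : ℝ≥0`), and the semigroup
is recovered from any one of its members on the dyadic multiples:

* `cfcSqrt_shiftH` — `CFC.sqrt (e^{-tH}) = e^{-(t/2)H}` (uniqueness of positive square roots,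
  `CFC.sqrt_unique`, from `e^{-(t/2)H} e^{-(t/2)H} = e^{-tH}` and `0 ≤ e^{-(t/2)H}`);
* `shiftH_div_two_pow_eq_nnrpow` — `e^{-(t/2ᵏ)H} = (e^{-tH}) ^ (2⁻¹)ᵏ` (iterate);
* `shiftH_pow`, `shiftH_dyadic_eq_nnrpow` — `e^{-(m t/2ᵏ)H} = (e^{-tH}) ^ (m (2⁻¹)ᵏ)` for `m ≥ 1`
  (semigroup law and `CFC.nnrpow_add`).

This is the algebraic half of the identification `e^{-tH} = (e^{-H})^t`; the extension from
dyadic to real `t` is done on matrix elements, by the strong continuity of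
`OSDistributionSpaceSemigroup` and dominated convergence for the scalar spectral measures
(next file). Nothing here is specific to OS beyond the inputs "symmetric contraction semigroup of
positive operators"; the statements are kept on `shiftH` because that is their only use.

## References
* K. Osterwalder, R. Schrader, Axioms for Euclidean Green's functions, CMP 31 (1973), §4.1,
  p. 92.
* J. Glimm, A. Jaffe, Quantum Physics (2nd ed. 1987), Thm. 6.1.3 (the contraction semigroup
  `e^{-tH}` and its generator).
-/

noncomputable section

open Filter
open _root_.Topology
open scoped InnerProductSpace NNReal

-- The `ℝ≥0` functional calculus on `ℋ →L[ℂ] ℋ` (`CFC.nnrpow`, `CFC.sqrt`) is reached through a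
-- long instance chain (C⋆-algebra ⟶ CFC over `ℂ` ⟶ `ℝ` ⟶ `ℝ≥0` via `StarOrderedRing` and
-- `NonnegSpectrumClass`); the default instance-synthesis budget is too small for it.
set_option synthInstance.maxHeartbeats 200000

namespace Literature.MathematicalPhysics.QuantumFieldTheory

variable {d : ℕ} [NeZero d]

section SchwingerFamily
open Literature.MathematicalPhysics.QuantumLattice (SchwingerFamily)
open Literature.MathematicalPhysics.QuantumLattice.SchwingerFamily
open Literature.MathematicalPhysics.QuantumLattice.SchwingerFamily.OSSpace

variable {𝔖 : SchwingerFamily (EuclideanSpace ℝ (Fin d))} {hE2 : 𝔖.IsOSReflectionPositive}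

/-- **Powers are multiples of the time**: `(e^{-tH})^m = e^{-(m t)H}` for `t ≥ 0` (semigroup
law), as an identity in the algebra `ℋ →L[ℂ] ℋ`. [folklore] -/
theorem _root_.Literature.MathematicalPhysics.QuantumLattice.SchwingerFamily.OSSpace.shiftH_pow (hE1 : 𝔖.IsEuclideanCovariant) {t : ℝ} (ht : 0 ≤ t) (m : ℕ) :
    shiftH hE2 t ^ m = shiftH hE2 (m * t) := by
  induction m with
  | zero =>
    rw [pow_zero, Nat.cast_zero, zero_mul]
    exact ContinuousLinearMap.ext fun ψ => (shiftH_zero_apply hE1 ψ).symm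
  | succ m ih =>
    rw [pow_succ, ih, Nat.cast_succ, add_mul, one_mul]
    refine ContinuousLinearMap.ext fun ψ => ?_
    rw [mul_apply_eq_comp, shiftH_add_apply hE1 (by positivity) ht]

/-- **`CFC.sqrt (e^{-tH}) = e^{-(t/2)H}`**: the positive square root of `e^{-tH}` in the C⋆-algebra
`ℋ →L[ℂ] ℋ` is `e^{-(t/2)H}` (`CFC.sqrt_unique`: `e^{-(t/2)H}` is positive and squares to
`e^{-tH}`). This is the first instance of the functional calculus `e^{-tH} = f(e^{-t₀H})`
replacing the spectral theorem in OS I §4.1. [cite: OsterwalderSchraderCMP1973, §4.1 p. 92] -/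
theorem _root_.Literature.MathematicalPhysics.QuantumLattice.SchwingerFamily.OSSpace.cfcSqrt_shiftH (hE1 : 𝔖.IsEuclideanCovariant) {t : ℝ} (ht : 0 ≤ t) :
    CFC.sqrt (shiftH hE2 t) = shiftH hE2 (t / 2) :=
  CFC.sqrt_unique (shiftH_half_mul_shiftH_half hE1 ht) (shiftH_nonneg hE1 _)

/-- **`e^{-(t/2ᵏ)H} = (e^{-tH}) ^ ((2⁻¹)ᵏ)`** (CFC power with exponent in `ℝ≥0`), by iterating
`cfcSqrt_shiftH` and `CFC.sqrt_nnrpow`. [folklore] -/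
theorem _root_.Literature.MathematicalPhysics.QuantumLattice.SchwingerFamily.OSSpace.shiftH_div_two_pow_eq_nnrpow (hE1 : 𝔖.IsEuclideanCovariant) {t : ℝ} (ht : 0 ≤ t) (k : ℕ) :
    shiftH hE2 (t / 2 ^ k) = shiftH hE2 t ^ ((2⁻¹ : ℝ≥0) ^ k) := by
  induction k with
  | zero =>
    rw [pow_zero, pow_zero, div_one, CFC.nnrpow_one (shiftH hE2 t) (shiftH_nonneg hE1 t)]
  | succ k ih =>
    have h1 : t / 2 ^ (k + 1) = t / 2 ^ k / 2 := by rw [pow_succ, div_div]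
    rw [h1, ← cfcSqrt_shiftH hE1 (by positivity), ih, CFC.sqrt_nnrpow, pow_succ, div_eq_mul_inv]

/-- Natural powers of CFC powers with positive exponent: `(a ^ x) ^ (m + 1) = a ^ ((m + 1) x)` for
`x > 0` (from `CFC.nnrpow_add`; stated for the operators at hand). [folklore] -/
theorem _root_.Literature.MathematicalPhysics.QuantumLattice.SchwingerFamily.OSSpace.nnrpow_pow_succ (a : OSHilbert 𝔖 hE2 →L[ℂ] OSHilbert 𝔖 hE2) {x : ℝ≥0} (hx : 0 < x)
    (m : ℕ) : (a ^ x) ^ (m + 1) = a ^ (((m : ℝ≥0) + 1) * x) := by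
  induction m with
  | zero => simp
  | succ m ih =>
    rw [pow_succ, ih, Nat.cast_succ]
    have hpos : 0 < ((m : ℝ≥0) + 1) * x := mul_pos (by positivity) hx
    rw [show ((m : ℝ≥0) + 1 + 1) * x = ((m : ℝ≥0) + 1) * x + x by ring, CFC.nnrpow_add hpos hx]

/-- **The semigroup on dyadic multiples is a CFC power of one member**:
`e^{-((m+1) t/2ᵏ)H} = (e^{-tH}) ^ ((m+1) (2⁻¹)ᵏ)` for `t ≥ 0` (Osterwalder–Schrader I (1973),
p. 92, `T^t = e^{-tH}` read through the functional calculus of the bounded operator `e^{-tH}`;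
Glimm–Jaffe Thm. 6.1.3). [cite: OsterwalderSchraderCMP1973, §4.1 p. 92] -/
theorem _root_.Literature.MathematicalPhysics.QuantumLattice.SchwingerFamily.OSSpace.shiftH_dyadic_eq_nnrpow (hE1 : 𝔖.IsEuclideanCovariant) {t : ℝ} (ht : 0 ≤ t) (m k : ℕ) :
    shiftH hE2 ((m + 1 : ℕ) * (t / 2 ^ k)) = shiftH hE2 t ^ (((m : ℝ≥0) + 1) * (2⁻¹ : ℝ≥0) ^ k) := by
  rw [← shiftH_pow hE1 (by positivity) (m + 1), shiftH_div_two_pow_eq_nnrpow hE1 ht k,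
    nnrpow_pow_succ _ (by positivity) m]

/-- The same identity with the dyadic rational written as a real number:
for `q = (m+1)/2ᵏ`, `e^{-(q t)H} = (e^{-tH}) ^ q`. [folklore] -/
theorem _root_.Literature.MathematicalPhysics.QuantumLattice.SchwingerFamily.OSSpace.shiftH_dyadic_eq_nnrpow' (hE1 : 𝔖.IsEuclideanCovariant) {t : ℝ} (ht : 0 ≤ t) (m k : ℕ) :
    shiftH hE2 (((m + 1 : ℕ) / 2 ^ k : ℝ) * t) =
      shiftH hE2 t ^ (((m : ℝ≥0) + 1) * (2⁻¹ : ℝ≥0) ^ k) := by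
  rw [← shiftH_dyadic_eq_nnrpow hE1 ht m k]
  congr 1
  ring

end SchwingerFamily

end Literature.MathematicalPhysics.QuantumFieldTheory
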